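import Summits.QuantumFields.BalabanUV.T4Continuum.Support.NE7MinActC2Lift
import Summits.QuantumFields.BalabanUV.T4Continuum.Support.NE7StabiliserLifting
import HarnessLib

/-!
# NE7MinActC2AllData — THE CONSTRAINED MINIMAL ACTION IS `C²` IN THE DATUM AT EVERY SMALL DATUM, UNCONDITIONALLY (ROAD-G115 §2)

For `d = 4`, every `U(n)`, every `L ≥ 2`: `∃ ε₀ > 0, ∀ 0 < ε ≤ ε₀, ∀ N ≥ 1, ∀ j, ∃ δ_V > 0` such that for EVERY unitary `N`-periodic datum `V₀` with `SmallField V₀ δ_V` the constrained minimal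
action of the `(j+1)`-fold problem, read in the exponential chart at `V₀`, `y ↦ minAct(chart_{V₀} y)` (`y ∈ skewSub N`), is of class `C²` at `0` (**`minAct_contDiffAt_two_allData`**) — the
second-order regularity behind «the effective action's quadratic form in the background field» at every small background, with NO genericity ∕ stabiliser hypothesis.
MECHANISM: `NE7MinActC2Lift.minAct_contDiffAt_two_of_lift` (this gen: second-order envelope theorem on the slice critical branch, under (G3′)) + ✓ p824904
`NE7StabiliserLifting.stabiliser_lifting` (row NE7b: (G3′) holds for every minimiser over every `δ_V(ε,n,N,L,j+1)`-small datum) + existence of minimisers (`thresholds`).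
Cell `pub-balaban`, rung (B)+1 sub-cell t4, lineage `b2b-balaban-t4-ne7-p1` (CRUX PROVER NE7 #1 = OWNER of BINDER row NE7), generation 115.  Memo `t4/b2b-balaban-t4-ne7-p1-g115/ROAD-G115.md` §2.
WHAT ([folklore]; 0 def, 0 sorry; `d = 4`, every `U(n)`, `L ≥ 2`).  HONEST FRAMING (page 1): composition of landed kernel theorems; QUANTIFIERS `∀ j ∃ δ_V` (the datum radius shrinks with the
level — row NE7b's lifting radius); radii existential; a `C²` GERM at each small datum in the chart at `V₀`, not a global statement; `C²`, NOT the analyticity [B11] p. 279 asserts; OUR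
minimisers (B11 (8) with `sfClass`), OUR route; nothing of Bałaban's asserted; NOT NE7 as a spine node, NOT NE3; spine 0∕9; finite T⁴ rung (B)+1 — NOT infinite volume, NOT mass gap, NOT
BetaPertH, NOT Clay.
-/

set_option autoImplicit false

open scoped BigOperators Matrix Matrix.Norms.L2Operator Topology
open NormedSpace Finset Set Filter Metric

namespace Summit.QuantumFields.BalabanUV.T4Continuum.NE7MinActC2AllData

open Literature.MathematicalPhysics.QuantumFieldTheory.Balaban1983to89
open B7Prop1Explicit B7Prop2Explicit
open T4AveragingDeficitWall (IsUnitaryCfg SmallField)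
open T4AveragingDeficitWallBoundary (IsPeriodicCfg)
open AveragingDeficitTorusChart (TDir chart)
open AveragingDeficitTwoLevelPrep (skewSub)
open AveragingDeficitMultiLevelPrep (tower)
open MinimalActionSandwich (IsMinimiser minAct)
open MinimalActionRate (sfClass)
open NE3EnergyShapes (IsUnitarySite IsPeriodicSite)
open NE7MinimalOrbitDatumContinuity (thresholds)
open NE7MinActC2Lift (minAct_contDiffAt_two_of_lift)
open NE7StabiliserLifting (stabiliser_lifting)

noncomputable section

variable {n : Type} [Fintype n] [DecidableEq n]

/-- **THE CONSTRAINED MINIMAL ACTION IS `C²` IN THE DATUM AT EVERY SMALL DATUM, UNCONDITIONALLY** (see the module docstring). [folklore] -/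
theorem minAct_contDiffAt_two_allData [Nonempty n] {L : ℕ} [NeZero L] (hL : 2 ≤ L) :
    ∃ ε₀ : ℝ, 0 < ε₀ ∧ ∀ ε : ℝ, 0 < ε → ε ≤ ε₀ → ∀ (N : ℕ) [NeZero N], 1 ≤ N → ∀ j : ℕ,
      ∃ δV : ℝ, 0 < δV ∧
        ∀ V₀ ∈ {V : Site 4 → Fin 4 → (Matrix n n ℂ)ˣ | IsUnitaryCfg V ∧ IsPeriodicCfg V (N : ℤ) ∧ SmallField V δV},
          ContDiffAt ℝ 2 (fun y : ↥(skewSub 4 n N) => minAct 4 (sfClass 4 L N ε) L N (j + 1) (chart (ContinuousLinearMap.id ℝ (Matrix n n ℂ)) N V₀ (y : TDir 4 n N))) 0 := by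
  obtain ⟨ε₁, hε₁, H⟩ := thresholds (n := n) hL
  obtain ⟨ε₂, hε₂, H2⟩ := minAct_contDiffAt_two_of_lift (n := n) hL
  obtain ⟨ε₃, hε₃, H3⟩ := stabiliser_lifting (n := n) hL
  refine ⟨min ε₁ (min ε₂ ε₃), lt_min hε₁ (lt_min hε₂ hε₃), fun ε hε hεle N _ hN j => ?_⟩
  obtain ⟨-, -, -, H1⟩ := H ε hε (hεle.trans (min_le_left _ _))
  obtain ⟨δ₁, hδ₁, hint₁⟩ := H1 N hN
  obtain ⟨δ₂, hδ₂, hC2⟩ := H2 ε hε (hεle.trans ((min_le_right _ _).trans (min_le_left _ _))) N hN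
  obtain ⟨δ₃, hδ₃, hlift⟩ := H3 ε hε (hεle.trans ((min_le_right _ _).trans (min_le_right _ _))) N hN (j + 1)
  refine ⟨min δ₁ (min δ₂ δ₃), lt_min hδ₁ (lt_min hδ₂ hδ₃), fun V₀ hV₀ => ?_⟩
  obtain ⟨hV₀u, hV₀P, hV₀δ⟩ := hV₀
  have hV₀1 : V₀ ∈ {V : Site 4 → Fin 4 → (Matrix n n ℂ)ˣ | IsUnitaryCfg V ∧ IsPeriodicCfg V (N : ℤ) ∧ SmallField V δ₁} :=
    ⟨hV₀u, hV₀P, MinimalActionRate.SmallField.mono hV₀δ (min_le_left _ _)⟩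
  have hV₀2 : V₀ ∈ {V : Site 4 → Fin 4 → (Matrix n n ℂ)ˣ | IsUnitaryCfg V ∧ IsPeriodicCfg V (N : ℤ) ∧ SmallField V δ₂} :=
    ⟨hV₀u, hV₀P, MinimalActionRate.SmallField.mono hV₀δ ((min_le_right _ _).trans (min_le_left _ _))⟩
  have hV₀3 : V₀ ∈ {V : Site 4 → Fin 4 → (Matrix n n ℂ)ˣ | IsUnitaryCfg V ∧ IsPeriodicCfg V (N : ℤ) ∧ SmallField V δ₃} :=
    ⟨hV₀u, hV₀P, MinimalActionRate.SmallField.mono hV₀δ ((min_le_right _ _).trans (min_le_right _ _))⟩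
  obtain ⟨Us, hUs, -⟩ := hint₁ V₀ hV₀1 (j + 1)
  obtain ⟨Sl, θS, KT, iK, zs, -, -, -, -, -, -, -, -, -, -, hC2', -⟩ :=
    hC2 V₀ hV₀2 j Us hUs fun s hsu hsP hsfix => hlift V₀ hV₀3 Us hUs s hsu hsP hsfix
  exact hC2'

end

end Summit.QuantumFields.BalabanUV.T4Continuum.NE7MinActC2AllData
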